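import Summits.CriticalPhenomena.PercolationContinuityZ3.Theorems.Transplant.FKConnectivityAllQOneSum
import Summits.CriticalPhenomena.PercolationContinuityZ3.Theorems.Transplant.FKConnectivityAllQDegThree
import HarnessLib

/-!
# Connectivity correlation inequalities for `φ_{w,q}`, every `q > 0` — negative correlation of ONE pair of pairs is preserved under
# one-point gluing (cut vertex / disjoint union), every `0 < q`

Helper file (`--supports stmt-CriticalPhenomena-4575`), FK sub-lane `prim-bschramm-fk-3` (gen 10) of the post-continuity programme;
builds on p205010 (kernel theorem, internal audit signed; external expert review pending).  No definitions, no named facts, no sorries;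
standard axioms.

The per-pair form of gen 8's `EdgeNegCorrSupp.oneSum` (`…AllQOneSum`), for fk-1 g7's `NegCorrPairSupp S q e f` (`…AllQDegThree`): if the
supports `E₁` (pairs on `V₁`) and `E₂` (pairs on `V₂`) are disjoint with `V₁ ∩ V₂ ⊆ {m}`, then negative correlation of `(e, f)` under
every `φ_{w,q}` supported in `E₁ ∪ E₂` follows from negative correlation of `(e, f)` on the side containing both pairs — and is automatic
(exact independence across the cut vertex, fk-2 g7's factorisation) when the two pairs lie on different sides
(**`negCorrPairSupp_union_of_cutVertex`**).  This is the gluing rule for the ADJACENT-pair programme (`EdgeNegCorrAdjFKLtOne`), whose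
blocks in the tree are now: supports spanning `≤ 5` vertices (`negCorrPairSupp_of_verts_card_le_five`, gen 10), hubs of degree `≤ 3` over
five further vertices, wheels and series–parallel / `K₄`-grown supports (full negative association); e.g. two `K₅`'s sharing a vertex.
[cite: Grimmett2006, §3.8 (pp. 61–62); §3.9 eq. (3.94) (p. 63)] [cite: Wagner2006, Conj. 5.3, §5.3 (p. 13)]
-/

noncomputable section

namespace Summit.CriticalPhenomena.PercolationContinuityZ3.Theorems

namespace FK

open MeasureTheory Literature.Probability.LatticeModels Literature.Probability.Percolation
open scoped Classical

variable {V : Type*} [Fintype V] {E₁ E₂ : Set (Sym2 V)} {V₁ V₂ : Set V} {m : V}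

/-- **One pair of pairs on one side of a cut vertex**: if `e, f ∈ E₁` and `(e, f)` is negatively correlated under every `φ_{w,q}`
supported in `E₁`, then also under every `φ_{w,q}` supported in `E₁ ∪ E₂` (`E₂` glued at a cut vertex or disjoint; `0 < q`): the three
probabilities are those of the restricted weight vector (gen 8's `rcMeasureW_real_eq_restrict_of_cutVertex`).
[cite: Grimmett2006, §3.8 (pp. 61–62); §3.9 eq. (3.94) (p. 63)] -/
theorem NegCorrPairSupp.oneSum_left {q : ℝ} (hq : 0 < q) (hd : Disjoint E₁ E₂) (h₁ : ∀ e ∈ E₁, ∀ z ∈ e, z ∈ V₁)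
    (h₂ : ∀ e ∈ E₂, ∀ z ∈ e, z ∈ V₂) (hS : V₁ ∩ V₂ ⊆ {m}) {e f : Sym2 V} (he : e ∈ E₁) (hf : f ∈ E₁)
    (h : NegCorrPairSupp E₁ q e f) : NegCorrPairSupp (E₁ ∪ E₂) q e f := by
  intro w hw
  have hr₁ : ∀ g, (((fun g => if g ∈ E₁ then w g else 0) g : unitInterval) : ℝ) ≠ 0 → g ∈ E₁ := by
    intro g hg; by_contra h'; exact hg (by simp [h'])
  rw [rcMeasureW_real_eq_restrict_of_cutVertex w hq hd h₁ h₂ hS hw ((determinedBy_openPair he).inter (determinedBy_openPair hf)),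
    rcMeasureW_real_eq_restrict_of_cutVertex w hq hd h₁ h₂ hS hw (determinedBy_openPair he),
    rcMeasureW_real_eq_restrict_of_cutVertex w hq hd h₁ h₂ hS hw (determinedBy_openPair hf)]
  exact h _ hr₁

/-- **Pairs on different sides of a cut vertex are negatively correlated** (in fact exactly independent; `0 < q`).
[cite: Grimmett2006, §3.8 (pp. 61–62)] -/
theorem negCorrPairSupp_of_cutVertex_cross {q : ℝ} (hq : 0 < q) (hd : Disjoint E₁ E₂) (h₁ : ∀ e ∈ E₁, ∀ z ∈ e, z ∈ V₁)
    (h₂ : ∀ e ∈ E₂, ∀ z ∈ e, z ∈ V₂) (hS : V₁ ∩ V₂ ⊆ {m}) {e f : Sym2 V} (he : e ∈ E₁) (hf : f ∈ E₂) :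
    NegCorrPairSupp (E₁ ∪ E₂) q e f := fun w hw =>
  (rcMeasureW_real_inter_eq_mul_of_cutVertex w hq hd h₁ h₂ hS hw (determinedBy_openPair he) (determinedBy_openPair hf)).le

/-- **Negative correlation of one pair of pairs is preserved under one-point gluing** (`0 < q`): for disjoint supports `E₁` (on `V₁`),
`E₂` (on `V₂`) with `V₁ ∩ V₂ ⊆ {m}`, `NegCorrPairSupp (E₁ ∪ E₂) q e f` follows from `NegCorrPairSupp Eᵢ q e f` for the side containing both
`e` and `f` (no hypothesis is needed when they lie on different sides, or when one of them is outside `E₁ ∪ E₂`).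
[cite: Grimmett2006, §3.8 (pp. 61–62); §3.9 eq. (3.94) (p. 63)] [cite: Wagner2006, Conj. 5.3, §5.3 (p. 13)] -/
theorem negCorrPairSupp_union_of_cutVertex {q : ℝ} (hq : 0 < q) (hd : Disjoint E₁ E₂) (h₁ : ∀ e ∈ E₁, ∀ z ∈ e, z ∈ V₁)
    (h₂ : ∀ e ∈ E₂, ∀ z ∈ e, z ∈ V₂) (hS : V₁ ∩ V₂ ⊆ {m}) {e f : Sym2 V}
    (hE₁ : e ∈ E₁ → f ∈ E₁ → NegCorrPairSupp E₁ q e f) (hE₂ : e ∈ E₂ → f ∈ E₂ → NegCorrPairSupp E₂ q e f) :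
    NegCorrPairSupp (E₁ ∪ E₂) q e f := by
  intro w hw
  by_cases he0 : ((w e : unitInterval) : ℝ) = 0
  · exact Wheel.negCorr_of_zero_left w hq f he0
  by_cases hf0 : ((w f : unitInterval) : ℝ) = 0
  · exact Wheel.negCorr_of_zero_right w hq e hf0
  have hS' : V₂ ∩ V₁ ⊆ {m} := by rwa [Set.inter_comm]
  rcases hw e he0 with he | he <;> rcases hw f hf0 with hf | hf
  · exact NegCorrPairSupp.oneSum_left hq hd h₁ h₂ hS he hf (hE₁ he hf) w hw
  · exact negCorrPairSupp_of_cutVertex_cross hq hd h₁ h₂ hS he hf w hw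
  · exact (negCorrPairSupp_of_cutVertex_cross hq hd h₁ h₂ hS hf he).symm w hw
  · have hw' : ∀ g, ((w g : unitInterval) : ℝ) ≠ 0 → g ∈ E₂ ∪ E₁ := fun g hg => by rw [Set.union_comm]; exact hw g hg
    have := NegCorrPairSupp.oneSum_left hq hd.symm h₂ h₁ hS' he hf (hE₂ he hf) w hw'
    exact this

end FK

end Summit.CriticalPhenomena.PercolationContinuityZ3.Theorems

end
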